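import Mathlib.LinearAlgebra.RootSystem.Base
import Mathlib.LinearAlgebra.RootSystem.Reduced
import Mathlib.FieldTheory.IsAlgClosed.Basic
import Literature.NumberTheory.Automorphic.LinearAlgebraicGroups
import Literature.NumberTheory.Automorphic.RootData
import Literature.NumberTheory.Automorphic.DualGroup
import Literature.NumberTheory.Automorphic.LParameter
import Literature.NumberTheory.GaloisRepresentations.AbsGaloisGroup
import HarnessLib

-- D-0014 sorry-sweep (operator, 2026-08-13): sorried theorems -> named facts `def X : Prop`; partial proofs preserved in comments
-- provenance: harness21/H21/H21/Statements/Lang/ReductiveDual.lean @ 2ad869e (interim HEAD d8f2665); M5 mechanical rewrite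
open scoped IsMulCommutative

/-!
# Langlands family (`lang`): root data, Chevalley's theorems, dual group and L-group
(statement **lang.S13**)

The inventory item **lang.S13** (SGA 3 Exp. XXV; Borel, *Automorphic L-functions*, Corvallis
1979, §§1–2; Buzzard–Gee 2014 §5.3) is a *definition*: "based root datum and its dual;
isomorphism classes of connected reductive groups over an algebraically closed field ↔ reduced
root data (Chevalley); dual group `Ĝ` and L-group `ᴸG = Ĝ ⋊ Γ_F`; C-group". The vocabulary is
the accepted prelude (trunk T-AUTOMORPHIC, G25 AutomorphicL, items I1–I3):
`IsConnectedReductive`, `IsMaximalTorusIn`, `characterLattice`, `cocharacterLattice`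
(item I1), `IsRootDatumOf`, `IsBasedRootDatumOf`, `Pinning`, `basedAutGroup` (item I2),
`LGroupData.DualGroupStr`, `cGroupElt` (item I3), G19's `LGroupData` (`ᴸG = L.LGroup`) and
G09's `Field.absoluteGaloisGroup`. Here the definitional target is restated, with the bold id,
as the theorems that make these definitions "the" classification (OUTLINE §3,
`LangReductiveDual`):

* (a) `Lang.flip_flip_root`: the dual based root datum is Mathlib's `(P.flip, b.flip)` and
  dualising twice gives back `(P, b)` (real proof, `rfl`);
* (b) `Lang.exists_isRootDatumOf`: a connected reductive `G` with maximal torus `T` over an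
  algebraically closed field *has* a (reduced) root datum (SGA 3 XXII 1.14; Springer, *Linear
  Algebraic Groups*, 7.4.3, 8.1);
* (c) `Lang.chevalley_existence`, `Lang.chevalley_existence_based`,
  `Lang.chevalley_isomorphism`: every reduced root datum is the root datum of a connected
  reductive group, unique up to isomorphism carrying `T` to `T'` and inducing the identity of
  the root datum (SGA 3 XXV 1.1–1.2; Springer 9.6.2, 10.1.1, 16.3.2–16.3.3);
* (d) `Lang.exists_dualGroupStr`: for every reduced based root datum `(P, b)` with a continuous
  action `μ : Γ_F → Aut(P, b)` there is an L-group datum `L` carrying a dual group structure with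
  `galRoot = μ`, i.e. the L-group `ᴸG = Ĝ ⋊ Γ_F` exists (Borel, Corvallis 1979, §I.2);
* (e) untagged `Lang.cGroupElt_central`: the Buzzard–Gee element `ε = (2ρ)(-1)` is central of
  order `≤ 2` and Galois fixed, so that the C-group `(Ĝ ⋊ Γ_F × 𝔾ₘ)/⟨(ε, -1)⟩` makes sense
  (Buzzard–Gee 2014, Prop. 5.3.3); proved from the prelude theorems.

## Mathlib search

Abstract (based) root data and their duals are entirely Mathlib's: `RootPairing`,
`RootPairing.flip`, `RootPairing.flip_flip` (`rfl`), `RootPairing.Base`, `RootPairing.Base.flip`,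
`RootPairing.IsReduced` (a class, with `RootPairing.instFlipIsReduced`), `RootPairing.Aut`,
and the abbreviation `RootPairing.RootDatum ι X Y := RootPairing ι ℤ X Y` whose docstring
prescribes the mixins `[Module.Finite ℤ X] [Module.Finite ℤ Y]` (freeness is then automatic) —
we follow it and write `RootPairing ι ℤ X Y` as the prelude does. Mathlib (this pin) has no
linear algebraic groups, no Chevalley classification, no dual group / L-group / C-group
(`rg -i 'chevalley'` only hits Chevalley's constructibility theorem, Chevalley–Warning and
Jordan–Chevalley; `rg -i 'dual ?group'` has no relevant hits). Nothing here duplicates a Mathlib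
declaration; there is nothing to *define* in this file.

## Design choices

* All declarations live in `namespace Literature.Lang`, with `open Literature.Automorphic`;
  `open scoped IsMulCommutative` right after the imports (OUTLINE §0 H2: the commutative-torus
  mixin is `[IsMulCommutative ↥T]`, giving the scoped `CommGroup ↥T` instance needed by
  `cocharacterLattice`).
* Faithfulness (OUTLINE D1, §4): the `k`-points vocabulary of item I1 is the textbook notion only
  over an algebraically closed field, so every statement assumes `[IsAlgClosed k]`; Chevalley's
  theorems are moreover stated in characteristic `0` (`[CharZero k]`), as fixed by the outline —
  they hold in every characteristic (SGA 3 XXV 1.1–1.2), but the case needed for dual groups is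
  `k = ℂ`.
* In the existence statements the new types (`ι X Y`, resp. the ambient `GL_N`) are quantified
  over `Type` / `ℕ` (OUTLINE §3; compare §0 H9): a root datum of a linear algebraic group has
  finitely many roots and finitely generated lattices, so nothing is lost.
* "Inducing the identity of `P`" in `chevalley_isomorphism` is stated pointwise on characters,
  `χ'_x (f t) = χ_x (t)` for `t ∈ T`, `x ∈ X`, via item I2's `charOfWeight`, exactly as the
  Galois compatibility `galAct_char` of item I3.
* `RootPairing.IsReduced` is a class in Mathlib, so reducedness hypotheses are instance
  arguments `[P.IsReduced]`.

## References

* M. Demazure, A. Grothendieck, *SGA 3*, Exp. XXI–XXV (esp. XXII 1.14, XXIII 4.1, XXV 1.1–1.2).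
* T. A. Springer, *Linear Algebraic Groups* (2nd ed., 1998), §§7.4, 8.1, 9.6, 10.1, 16.3.
* A. Borel, *Automorphic L-functions*, Proc. Symp. Pure Math. 33.2 (Corvallis 1979), §§I.1–I.2.
* K. Buzzard, T. Gee, *The conjectural connections between automorphic representations and
  Galois representations* (2014), §5.3, Prop. 5.3.3.
-/

noncomputable section

open Field
open scoped MatrixGroups

namespace Literature.NumberTheory.Automorphic


/-! ### (a) The dual based root datum -/

section Dual

variable {ι R M N : Type*} [CommRing R] [AddCommGroup M] [Module R M] [AddCommGroup N]
  [Module R N]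

/-- **lang.S13** (a) (the dual based root datum; SGA 3 XXI 6.2, XXII 1.13; Springer 7.4.3;
Borel, Corvallis 1979, §I.2). The dual of the based root datum `(P, b) = (X, Φ, Δ, Y, Φ^∨, Δ^∨)`
is Mathlib's `(P.flip, b.flip) = (Y, Φ^∨, Δ^∨, X, Φ, Δ)`: its roots are the coroots of `P`, its
simple roots are indexed by the same `b.support`, and dualising twice is the identity
(definitionally). Sanity restatement of Mathlib's `RootPairing.flip_flip`,
`RootPairing.flip_root`, `RootPairing.Base.flip_support`. [cite: BorelCorvallis1979, §I.2] -/
theorem flip_flip_root (P : RootPairing ι R M N) (b : P.Base) :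
    P.flip.flip.root = P.root ∧ P.flip.root = P.coroot ∧ b.flip.support = b.support ∧
      b.flip.flip = b :=
  ⟨rfl, rfl, rfl, rfl⟩

end Dual

/-! ### (b) The root datum of a connected reductive group -/

section RootDatum

variable {k : Type*} [Field k] {n : Type*} [Fintype n] [DecidableEq n]
variable {G T : Subgroup (GL n k)}

/-- **lang.S13** (b) (existence of the root datum; SGA 3 XXII 1.14; Springer, *Linear Algebraic
Groups*, 7.4.3 with 8.1.1–8.1.3, 8.1.8). Let `G` be a connected reductive group over an
algebraically closed field and `T ≤ G` a maximal torus. Then `Ψ(G, T) = (X*(T), Φ, X_*(T), Φ^∨)`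
is a reduced root datum: there are a finite index type `ι`, lattices `X ≃ X*(T)`, `Y ≃ X_*(T)` and
a Mathlib root pairing `P : RootPairing ι ℤ X Y` which *is the root datum of* `(G, T)`
(`IsRootDatumOf`, item I2), and `P` is reduced (Springer 7.4.3–7.4.4).
[cite: SpringerLAG1998, Thm 7.4.3 with 8.1.1–8.1.3] -/
def exists_isRootDatumOf : Prop :=
  ∀ [IsAlgClosed k] (_hG : IsConnectedReductive G) (_hT : IsMaximalTorusIn T G)
    [IsMulCommutative ↥T],
    ∃ (ι X Y : Type) (_ : Fintype ι) (_ : AddCommGroup X) (_ : AddCommGroup Y)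
      (P : RootPairing ι ℤ X Y) (eX : Additive ↥(characterLattice T) ≃+ X)
      (eY : Additive ↥(cocharacterLattice T) ≃+ Y), IsRootDatumOf G T P eX eY ∧ P.IsReduced

end RootDatum

/-! ### (c) Chevalley's existence and isomorphism theorems -/

section Chevalley

variable (k : Type*) [Field k]
variable {ι X Y : Type*} [AddCommGroup X] [AddCommGroup Y]

/-- **lang.S13** (c) (Chevalley's existence theorem; SGA 3 XXV 1.2; Chevalley, Séminaire
1956–58 / Tôhoku 1955; Springer, *Linear Algebraic Groups*, 10.1.1 with 9.6.2, 16.3.3). Every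
reduced root datum `P = (X, Φ, Y, Φ^∨)` (finite `Φ`, finitely generated lattices `X`, `Y`) over
an algebraically closed field `k` of characteristic `0` is the root datum of a connected
reductive linear algebraic group: there are `N`, a connected reductive `G ≤ GL_N(k)`, a maximal
torus `T ≤ G` and identifications `X*(T) ≃ X`, `X_*(T) ≃ Y` with `IsRootDatumOf G T P eX eY`.
Freeness of `X`, `Y` is automatic (Mathlib `RootPairing.RootDatum`). The theorem holds in every
characteristic; characteristic `0` is the case fixed by the outline (dual groups over `ℂ`).
[cite: SpringerLAG1998, Thm 10.1.1 with 9.6.2] -/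
def chevalley_existence : Prop :=
  ∀ [IsAlgClosed k] [CharZero k] [Finite ι] [Module.Finite ℤ X] [Module.Finite ℤ Y]
    (P : RootPairing ι ℤ X Y) [P.IsReduced],
    ∃ (N : ℕ) (G T : Subgroup (GL (Fin N) k)) (_ : IsMulCommutative ↥T)
      (eX : Additive ↥(characterLattice T) ≃+ X) (eY : Additive ↥(cocharacterLattice T) ≃+ Y),
      IsConnectedReductive G ∧ IsMaximalTorusIn T G ∧ IsRootDatumOf G T P eX eY

/-- **lang.S13** (c) (Chevalley's existence theorem, based / pinned form; SGA 3 XXV 1.2 with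
XXII 5.5.1, XXIII 1.1; Springer 10.1.1, 8.2.4, 9.6.1). Every reduced *based* root datum `(P, b)`
over an algebraically closed field of characteristic `0` is the based root datum of a triple
`(G, B, T)` — `G ≤ GL_N(k)` connected reductive, `T` a maximal torus, `B ⊇ T` the Borel subgroup
of the positive system of `b` (`IsBasedRootDatumOf`) — and `(G, B, T)` admits a pinning
(`Pinning`). [cite: SpringerLAG1998, Thm 10.1.1 with 8.2.4, 9.6.1] -/
def chevalley_existence_based : Prop :=
  ∀ [IsAlgClosed k] [CharZero k] [Finite ι] [Module.Finite ℤ X] [Module.Finite ℤ Y]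
    (P : RootPairing ι ℤ X Y) [P.IsReduced] (b : P.Base),
    ∃ (N : ℕ) (G B T : Subgroup (GL (Fin N) k)) (_ : IsMulCommutative ↥T)
      (eX : Additive ↥(characterLattice T) ≃+ X) (eY : Additive ↥(cocharacterLattice T) ≃+ Y)
      (h : IsBasedRootDatumOf G T B P b eX eY), IsConnectedReductive G ∧ IsMaximalTorusIn T G ∧
        Nonempty (Pinning G T h.isRootDatumOf.le P b eX)

variable {k}
variable {N N' : ℕ} {G T : Subgroup (GL (Fin N) k)} {G' T' : Subgroup (GL (Fin N') k)}
  [IsMulCommutative ↥T] [IsMulCommutative ↥T']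

/-- **lang.S13** (c) (Chevalley's isomorphism theorem; SGA 3 XXIII 4.1, XXV 1.1; Springer,
*Linear Algebraic Groups*, 9.6.2, 16.3.2; Humphreys 32.1). Over an algebraically closed field of
characteristic `0`, two connected reductive groups `(G, T)`, `(G', T')` realising the *same* root
datum `P` (through `eX, eY`, resp. `eX', eY'`) are isomorphic: there is a group isomorphism
`f : G ≃* G'`, algebraic in both directions, carrying `T` onto `T'`, and inducing the identity of
`P`, i.e. for every weight `x ∈ X` the character `χ'_x` of `T'` pulls back along `f` to the
character `χ_x` of `T` (hence also `f ∘ λ_y = λ'_y` on cocharacters, by perfectness of the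
pairing). More generally any isomorphism of root data is induced by such an `f`, unique up to
`Int(t)`, `t ∈ T` (Springer 16.3.2); the version for equal data suffices after transport.
[cite: SpringerLAG1998, Thm 9.6.2 and 16.3.2] -/
def chevalley_isomorphism : Prop :=
  ∀ [IsAlgClosed k] [CharZero k] (_hG : IsConnectedReductive G) (_hT : IsMaximalTorusIn T G)
    (_hG' : IsConnectedReductive G') (_hT' : IsMaximalTorusIn T' G') {P : RootPairing ι ℤ X Y}
    {eX : Additive ↥(characterLattice T) ≃+ X} {eY : Additive ↥(cocharacterLattice T) ≃+ Y}
    {eX' : Additive ↥(characterLattice T') ≃+ X} {eY' : Additive ↥(cocharacterLattice T') ≃+ Y}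
    (_h : IsRootDatumOf G T P eX eY) (_h' : IsRootDatumOf G' T' P eX' eY'),
    ∃ f : ↥G ≃* ↥G',
      MonoidHom.IsAlgebraicGL (G'.subtype.comp f.toMonoidHom) ∧
      MonoidHom.IsAlgebraicGL (G.subtype.comp f.symm.toMonoidHom) ∧
      ∃ hf : ∀ g : ↥G, ((f g : ↥G') : GL (Fin N') k) ∈ T' ↔ (g : GL (Fin N) k) ∈ T,
        ∀ (x : X) (t : ↥G) (ht : (t : GL (Fin N) k) ∈ T),
          charOfWeight eX' x ⟨((f t : ↥G') : GL (Fin N') k), (hf t).mpr ht⟩ =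
            charOfWeight eX x ⟨(t : GL (Fin N) k), ht⟩

end Chevalley

/-! ### (d) Existence of the dual group / L-group -/

section DualGroup

variable {F : Type*} [Field F]
variable {ι X Y : Type*} [AddCommGroup X] [AddCommGroup Y]

/-- **lang.S13** (d) (the dual group and the L-group exist; Borel, *Automorphic L-functions*,
Corvallis 1979, §I.2 (2.1–2.4); Langlands 1970; Springer 9.6.2, 16.3.3). Let `(P, b)` be a
reduced based root datum (think `Ψ₀(G)` of a connected reductive `G/F`) with an action
`μ : Γ_F → Aut(P, b)` of the absolute Galois group factoring through a finite quotient (open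
kernel). Then there is an L-group datum `L` over `F` (G19: `Ĝ = L.dual ≤ GL_N(ℂ)` with Galois
action `L.galAct`, `ᴸG = Ĝ ⋊ Γ_F = L.LGroup`) together with a dual group structure
`D : L.DualGroupStr P b` (item I3: `Ĝ` connected reductive with maximal torus and Borel
`T̂ ≤ B̂`, based root datum `(P.flip, b.flip)`, a pinning, and `L.galAct` the L-action attached to
`μ` and the pinning) whose Galois action on the root datum is the given `μ`. This is Chevalley
existence over `ℂ` for `P.flip` plus the splitting `Aut(Ĝ, B̂, T̂, {u_α}) ≃ Aut(Ψ₀(Ĝ))`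
(Springer 16.3.3 / SGA 3 XXIV 3.10). [cite: BorelCorvallis1979, §I.2 (2.1)–(2.4)] -/
def exists_dualGroupStr : Prop :=
  ∀ [Finite ι] [Module.Finite ℤ X] [Module.Finite ℤ Y] (P : RootPairing ι ℤ X Y) [P.IsReduced]
    (b : P.Base) (a : absoluteGaloisGroup F →* ↥(basedAutGroup P b))
    (_ha : IsOpen (a.ker : Set (absoluteGaloisGroup F))),
    ∃ L : LGroupData F, ∃ D : L.DualGroupStr P b, D.galRoot = a

/-! ### (e) The C-group element -/

variable {L : LGroupData F} {P : RootPairing ι ℤ X Y} {b : P.Base} [Fintype ι]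

/-- (untagged; Buzzard–Gee, *The conjectural connections between automorphic representations and
Galois representations* (2014), §5.3, Prop. 5.3.3.) For a dual group structure `D` on `L`, the
Buzzard–Gee element `ε = (2ρ)(-1) ∈ T̂` (item I3 `cGroupElt`) is central in `Ĝ`, Galois fixed
(`ε ∈ Z(Ĝ)^Γ`, G19 `LGroupData.centerFixed`) and satisfies `ε² = 1`; consequently
`⟨(ε, -1)⟩ ≤ (Ĝ ⋊ Γ_F) × 𝔾ₘ` is a central subgroup of order `≤ 2` and the C-group
`ᶜG = ((Ĝ ⋊ Γ_F) × 𝔾ₘ) / ⟨(ε, -1)⟩` is defined (BG Prop. 5.3.3; not built here, OUTLINE §4).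
Follows from the named facts `cGroupElt_mem_center`, `galAct_cGroupElt` and the theorem
`cGroupElt_sq` (`cGroupElt_central_of`). [cite: BuzzardGeeLMS2014, §5.3, Prop. 5.3.3] -/
def cGroupElt_central : Prop :=
  ∀ (D : L.DualGroupStr P b),
    D.cGroupElt ∈ Subgroup.center ↥L.dual ∧ D.cGroupElt ∈ L.centerFixed ∧ D.cGroupElt ^ 2 = 1

/-- The conclusion of `cGroupElt_central` for a dual group structure `D`, from the named facts
`cGroupElt_mem_center` and `galAct_cGroupElt` of `DualGroup` (threaded as hypotheses, D-0014)
and the theorem `cGroupElt_sq`. [cite: BuzzardGeeLMS2014, §5.3, Prop. 5.3.3] -/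
theorem cGroupElt_central_of (D : L.DualGroupStr P b) (hc : D.cGroupElt_mem_center)
    (hg : D.galAct_cGroupElt) :
    D.cGroupElt ∈ Subgroup.center ↥L.dual ∧ D.cGroupElt ∈ L.centerFixed ∧ D.cGroupElt ^ 2 = 1 :=
  ⟨hc, D.cGroupElt_mem_centerFixed hc hg, D.cGroupElt_sq⟩

/-- `cGroupElt_central` holds, given the named facts `cGroupElt_mem_center` and `galAct_cGroupElt`
for every dual group structure. [cite: BuzzardGeeLMS2014, §5.3, Prop. 5.3.3] -/
theorem cGroupElt_central_holds (hc : ∀ D : L.DualGroupStr P b, D.cGroupElt_mem_center)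
    (hg : ∀ D : L.DualGroupStr P b, D.galAct_cGroupElt) :
    cGroupElt_central (L := L) (P := P) (b := b) :=
  fun D => cGroupElt_central_of D (hc D) (hg D)

end DualGroup

end Literature.NumberTheory.Automorphic
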